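import Summits.SmoothPoincare4.SmoothPoincare4.Theorems.ConvexBisectionContractibleHalvesOfSimplyConnectedSeamPieces
import Literature.Topology.FourManifolds.ContractibleOfConnectedBoundary
import Literature.Topology.FourManifolds.SphereSimplyConnected
import Literature.Topology.FourManifolds.HomotopyS4CompactProofs
import Literature.AlgebraicTopology.SingularHomology.ExcisionMayerVietorisProofs
import Literature.AlgebraicTopology.SingularHomology.SimplyConnectedH1
import Literature.AlgebraicTopology.SingularHomology.KroneckerDegreeOne
import HarnessLib

/-!
# Both halves of a bisection of a homotopy 4-sphere with simply connected seam are contractible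
(item stmt-SmoothPoincare4-15219 `ContractibleHalvesOfSimplyConnectedSeam`, route
route-SmoothPoincare4-ConvexBisection; the signature of the item is proved verbatim by
`Summit.SmoothPoincare4.SmoothPoincare4.Theorems.convexBisection_contractibleHalvesOfSimplyConnectedSeam`)

Let `M ≃ S⁴` be a Hausdorff second-countable smooth `4`-manifold covered by two smoothly embedded
compact `4`-manifolds with boundary `e₁(W₁) ∪ e₂(W₂)` meeting exactly along the images of their
boundaries, `range e₁ ∩ range e₂ = e₁(∂W₁) = e₂(∂W₂)`, with simply connected seam.  Then `W₁` and
`W₂` are contractible.  Proof (Perelman-free, pure algebraic topology, everything proved in the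
tree):

1. the bisection is a boundary gluing `M = W₁ ∪_Ψ W₂` of the null-cobordisms `(Wᵢ, ∂Wᵢ)` of the
   abstract boundaries along the seam bijection `Ψ = incl₂⁻¹ ∘ e₂⁻¹ ∘ e₁ ∘ incl₁`
   (`Literature.Topology.FourManifolds.BoundaryGluingData`);
2. the halves are path connected and, by van Kampen in free-product form over the bicollar of the
   seam, simply connected (`simplyConnectedSpace_left`, the Pieces file);
3. `isZero_singularHomology_left`: `H¹(W₂; ℤ) = 0`, so Lefschetz duality gives
   `H₃(W₂, ∂W₂) = 0`, the map of pairs `(W₂, ∂W₂) → (M, e₁ W₁)` is a relative-homology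
   isomorphism (`BoundaryGluingData.isIso_map_jB_boundary'`), and the sequence of the pair
   `0 = H₃(M, e₁ W₁) → H₂(e₁ W₁) → H₂(M) = 0` kills `H₂(W₁)`; `H₁(W₁) = 0` as `π₁ = 1`;
4. the tree's recognition theorem
   `Literature.Topology.FourManifolds.contractibleSpace_of_isZero_singularHomology_of_boundary_connected`
   (`m = 2`: compact simply connected `4`-manifold with connected nonempty boundary and
   `H₁ = H₂ = 0` is contractible — Lefschetz duality, Hurewicz, Whitehead) concludes.

No definitions, no named facts; axioms `propext`, `Classical.choice`, `Quot.sound`.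

## References

* A. Hatcher, *Algebraic Topology*, CUP 2002, Thm. 1.20, Thm. 2.16, Thm. 2.20, Thm. 3.43,
  Thm. 4.5, Cor. 4.33. [HatcherAT2002]
* M. Kervaire, J. Milnor, *Groups of homotopy spheres I*, Ann. of Math. 77 (1963), p. 514.
  [KervaireMilnorAnnals1963]
* R. Kirby, *Akbulut's corks and h-cobordisms of smooth, simply connected 4-manifolds*,
  arXiv:math/9712231, §3. [KirbyCorks1996]
-/

noncomputable section

-- the prescribed namespace `Summit.<P>.<Sub>.…` duplicates `SmoothPoincare4` (P = Sub)
set_option linter.dupNamespace false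

open scoped Manifold ContDiff Topology unitInterval ContinuousMap
open Set Function CategoryTheory CategoryTheory.Limits Topology
open Literature.AlgebraicTopology.SingularHomology Literature.Topology.FourManifolds
open Literature.AlgebraicTopology.FundamentalGroup
open Literature.AlgebraicTopology.Homotopy

namespace Summit.SmoothPoincare4.SmoothPoincare4.Theorems

namespace ConvexBisection.ContractibleHalves

/-! ### Homology of a piece in the middle degree -/

section Piece

variable {m : ℕ}
variable {S : Type} [TopologicalSpace S] [ChartedSpace (EuclideanSpace ℝ (Fin (m + 1))) S]
  [IsManifold (𝓡 (m + 1)) ∞ S]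
variable {S' : Type} [TopologicalSpace S'] [ChartedSpace (EuclideanSpace ℝ (Fin (m + 1))) S']
  [IsManifold (𝓡 (m + 1)) ∞ S']
variable {cM : NullCobordism (m + 1) S} {cN : NullCobordism (m + 1) S'} {φ : S ≃ S'}
variable {P : Type} [TopologicalSpace P] [ChartedSpace (EuclideanSpace ℝ (Fin (m + 1 + 1))) P]
  [IsManifold (𝓡 (m + 1 + 1)) ∞ P]
variable (G : BoundaryGluingData cM.boundaryData cN.boundaryData φ P)

include G in
/-- **`H_m(M; ℤ) = 0` for the first piece of a gluing `P = M ∪_φ N` of `(m+2)`-manifolds with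
`H_m(P; ℤ) = 0` and `N` simply connected.**  Lefschetz duality for the compact simply connected
`N` (`bijective_relCapProduct_of_isRelFundamentalClass_holds`, Hatcher Thm. 3.43) gives
`H_{m+1}(N, ∂N) ≅ H¹(N) = 0` (`H¹ = 0` for simply connected spaces); the piece `N` as a map of
pairs `(N, ∂N) → (P, jA M)` is an isomorphism on relative homology (excision and collars,
`BoundaryGluingData.isIso_map_jB_boundary'`), so `H_{m+1}(P, jA M) = 0` and the sequence of the
pair `H_{m+1}(P, jA M) → H_m(jA M) → H_m(P) = 0` kills `H_m(jA M) ≅ H_m(M)`.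
[cite: HatcherAT2002, Thm. 3.43, Thm. 2.20, Thm. 2.16] -/
theorem isZero_singularHomology_left [CompactSpace S'] [T2Space S'] [Nonempty S']
    [SimplyConnectedSpace cN.W] (hP : IsZero (singularHomology ℤ ℤ P m)) :
    IsZero (singularHomology ℤ ℤ cM.W m) := by
  -- `H¹(N; ℤ) = 0` and Lefschetz duality: `H_{m+1}(N, ∂N; ℤ) = 0`
  have hcoh : IsZero (singularCohomology ℤ ℤ cN.W 1) :=
    isZero_singularCohomology_one_of_simplyConnectedSpace ℤ
  obtain ⟨z, hz⟩ := exists_isRelFundamentalClass_of_simplyConnectedSpace (m + 1) cN.W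
  have hb := bijective_relCapProduct_of_isRelFundamentalClass_holds (R := ℤ) (m + 1) cN.W z hz
    (p := 1) (q := m + 1) (by omega)
  haveI : Subsingleton (singularCohomology ℤ ℤ cN.W 1) := ModuleCat.subsingleton_of_isZero hcoh
  have hN : IsZero (relativeSingularHomology ℤ ℤ cN.W ((𝓡∂ (m + 1 + 1)).boundary cN.W)
      (m + 1)) := by
    haveI : Subsingleton (relativeSingularHomology ℤ ℤ cN.W
        ((𝓡∂ (m + 1 + 1)).boundary cN.W) (m + 1)) := hb.surjective.subsingleton
    exact ModuleCat.isZero_of_subsingleton _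
  -- `jB_* : H_{m+1}(N, ∂N) ≅ H_{m+1}(P, jA M)`
  haveI := G.isIso_map_jB_boundary' ℤ ℤ (m + 1)
  have hPA : IsZero (relativeSingularHomology ℤ ℤ P (range G.jA) (m + 1)) :=
    hN.of_iso (asIso (relativeSingularHomology.map ℤ ℤ (⟨G.jB, G.continuous_jB⟩ : C(cN.W, P))
      G.mapsTo_jB_boundary (m + 1))).symm
  -- the sequence of the pair: `H_m(jA M) → H_m(P) = 0` is injective
  haveI : Mono (singularHomology.map ℤ ℤ (subsetIncl (range G.jA)) m) :=
    (relativeSingularHomology.exact_δ_map ℤ ℤ (range G.jA) m).mono_g (hPA.eq_of_src _ _)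
  have hA : IsZero (singularHomology ℤ ℤ ↥(range G.jA) m) :=
    hP.of_mono (singularHomology.map ℤ ℤ (subsetIncl (range G.jA)) m)
  exact hA.of_iso (singularHomology.mapIso ℤ ℤ G.isSmoothEmbedding_jA.isEmbedding.toHomeomorph m)

end Piece

/-! ### Dimension four: the pieces are contractible -/

section Four

variable {S : Type} [TopologicalSpace S] [ChartedSpace (EuclideanSpace ℝ (Fin (2 + 1))) S]
  [IsManifold (𝓡 (2 + 1)) ∞ S]
variable {S' : Type} [TopologicalSpace S'] [ChartedSpace (EuclideanSpace ℝ (Fin (2 + 1))) S']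
  [IsManifold (𝓡 (2 + 1)) ∞ S']
variable {cM : NullCobordism (2 + 1) S} {cN : NullCobordism (2 + 1) S'} {φ : S ≃ S'}
variable {P : Type} [TopologicalSpace P] [ChartedSpace (EuclideanSpace ℝ (Fin (2 + 1 + 1))) P]
  [IsManifold (𝓡 (2 + 1 + 1)) ∞ P]

/-- **A half of a bisected homotopy `4`-sphere with simply connected seam is contractible.**
For a boundary gluing `P = M ∪_φ N` of two compact `4`-manifolds with (nonempty, connected)
boundary with `P ≃ S⁴` and simply connected seam: the pieces are path connected
(`pathConnectedSpace_left`) and simply connected (van Kampen, `simplyConnectedSpace_left`),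
`H₁(M) = 0` (`π₁ = 1`) and `H₂(M) = 0` (`isZero_singularHomology_left`, as `H₂(S⁴) = 0`), and a
compact simply connected `4`-manifold with connected nonempty boundary and `H₁ = H₂ = 0` is
contractible (`contractibleSpace_of_isZero_singularHomology_of_boundary_connected`: Lefschetz
duality, Hurewicz, Whitehead; Kervaire–Milnor 1963, p. 514).
[cite: KervaireMilnorAnnals1963, p. 514] [cite: HatcherAT2002, Thm. 1.20, Thm. 3.43, Cor. 4.33] -/
theorem contractibleSpace_left [CompactSpace S] [T2Space S] [Nonempty S] [PathConnectedSpace S]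
    [CompactSpace S'] [T2Space S'] [Nonempty S'] [PathConnectedSpace S']
    (G : BoundaryGluingData cM.boundaryData cN.boundaryData φ P)
    (hP : P ≃ₕ Metric.sphere (0 : EuclideanSpace ℝ (Fin 5)) 1)
    (hsc : IsSimplyConnected G.seam) (hsc' : IsSimplyConnected G.symm.seam) :
    ContractibleSpace cM.W := by
  -- `P` is path connected and simply connected, with `H₂(P; ℤ) = H₂(S⁴; ℤ) = 0`
  haveI : PathConnectedSpace P := by
    haveI := pathConnectedSpace_sphere_four
    exact pathConnectedSpace_of_homotopyEquiv hP
  haveI : SimplyConnectedSpace P := by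
    haveI : SimplyConnectedSpace (Metric.sphere (0 : EuclideanSpace ℝ (Fin 5)) 1) :=
      simplyConnectedSpace_sphere_four_holds
    exact hP.simplyConnectedSpace
  have hP2 : IsZero (singularHomology ℤ ℤ P 2) :=
    (isZero_singularHomology_sphere_holds ℤ ℤ (k := 2) (by norm_num) (by norm_num)).of_iso
      (singularHomology.isoOfHomotopyEquiv ℤ ℤ hP 2)
  -- the pieces are path connected, then simply connected
  haveI : PathConnectedSpace cM.W := pathConnectedSpace_left G
  haveI : PathConnectedSpace cN.W := pathConnectedSpace_left G.symm
  haveI : SimplyConnectedSpace cM.W := simplyConnectedSpace_left G hsc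
  haveI : SimplyConnectedSpace cN.W := simplyConnectedSpace_left G.symm hsc'
  -- `H₂(M; ℤ) = 0`
  have h2 : IsZero (singularHomology ℤ ℤ cM.W 2) := isZero_singularHomology_left G hP2
  -- the boundary `∂M = incl(S)` is nonempty and connected
  obtain ⟨z₀⟩ := (inferInstance : Nonempty S)
  have hne : ((𝓡∂ (2 + 1 + 1)).boundary cM.W).Nonempty := ⟨cM.incl z₀, cM.incl_mem_boundary z₀⟩
  have hconn : IsConnected ((𝓡∂ (2 + 1 + 1)).boundary cM.W) := by
    rw [← cM.range_incl]
    exact (isPathConnected_range cM.continuous_incl).isConnected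
  -- recognition
  have hH : ∀ q : ℕ, 1 ≤ q → q ≤ 2 → IsZero (singularHomology ℤ ℤ cM.W q) := by
    intro q hq1 hq2
    interval_cases q
    · exact isZero_singularHomology_one_of_simplyConnectedSpace ℤ ℤ
    · exact h2
  exact contractibleSpace_of_isZero_singularHomology_of_boundary_connected (m := 2) (by norm_num)
    cM.W hne hconn hH

end Four

end ConvexBisection.ContractibleHalves

open ConvexBisection.ContractibleHalves in
/-- **Both halves of a bisection of a homotopy `4`-sphere with simply connected seam are
contractible** (item stmt-SmoothPoincare4-15219 `ContractibleHalvesOfSimplyConnectedSeam` of route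
ConvexBisection, signature verbatim).  For every Hausdorff second-countable smooth `4`-manifold
`M ≃ S⁴` covered by two smoothly embedded compact `4`-manifolds with boundary `e₁(W₁) ∪ e₂(W₂)`
meeting exactly along the images of their boundaries, if the seam `range e₁ ∩ range e₂` is simply
connected then `W₁` and `W₂` are contractible: present the bisection as a boundary gluing of the
null-cobordisms `(Wᵢ, ∂Wᵢ)` along the seam bijection, and apply `contractibleSpace_left` to the
gluing data and to the swapped data (van Kampen; Lefschetz duality and the sequence of the pair;
the recognition theorem for compact simply connected `4`-manifolds with connected boundary and
`H₁ = H₂ = 0`).  [cite: HatcherAT2002, Thm. 1.20, Thm. 3.43, Thm. 4.5 and Cor. 4.33]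
[cite: KervaireMilnorAnnals1963, p. 514] -/
theorem convexBisection_contractibleHalvesOfSimplyConnectedSeam :
    ∀ (M : Type) [TopologicalSpace M] [T2Space M] [SecondCountableTopology M]
      [ChartedSpace (EuclideanSpace ℝ (Fin 4)) M] [IsManifold (𝓡 4) ∞ M],
      M ≃ₕ Metric.sphere (0 : EuclideanSpace ℝ (Fin 5)) 1 →
      ∀ (W₁ : Type) [TopologicalSpace W₁] [ChartedSpace (EuclideanHalfSpace 4) W₁]
        [IsManifold (𝓡∂ 4) ∞ W₁] [CompactSpace W₁]
        (W₂ : Type) [TopologicalSpace W₂] [ChartedSpace (EuclideanHalfSpace 4) W₂]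
        [IsManifold (𝓡∂ 4) ∞ W₂] [CompactSpace W₂] (e₁ : W₁ → M) (e₂ : W₂ → M),
        Manifold.IsSmoothEmbedding (𝓡∂ 4) (𝓡 4) ∞ e₁ →
        Manifold.IsSmoothEmbedding (𝓡∂ 4) (𝓡 4) ∞ e₂ →
        Set.range e₁ ∪ Set.range e₂ = Set.univ →
        Set.range e₁ ∩ Set.range e₂ = e₁ '' (𝓡∂ 4).boundary W₁ →
        Set.range e₁ ∩ Set.range e₂ = e₂ '' (𝓡∂ 4).boundary W₂ →
        SimplyConnectedSpace ↥(Set.range e₁ ∩ Set.range e₂) →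
        ContractibleSpace W₁ ∧ ContractibleSpace W₂ := by
  intro M _ _ _ _ _ hM W₁ _ _ _ _ W₂ _ _ _ _ e₁ e₂ h₁ h₂ hcov hI₁ hI₂ hsc
  -- separation and countability of the halves, which embed in `M`
  haveI : T2Space W₁ := h₁.isEmbedding.t2Space
  haveI : T2Space W₂ := h₂.isEmbedding.t2Space
  haveI : SecondCountableTopology W₁ := h₁.isEmbedding.secondCountableTopology
  haveI : SecondCountableTopology W₂ := h₂.isEmbedding.secondCountableTopology
  -- abstract boundaries, and the halves as null-cobordisms of them
  obtain ⟨b₁⟩ := nonempty_boundaryData_holds 3 W₁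
  obtain ⟨b₂⟩ := nonempty_boundaryData_holds 3 W₂
  let c₁ : NullCobordism (2 + 1) b₁.carrier :=
    { W := W₁, incl := b₁.incl, isSmoothEmbedding_incl := b₁.isSmoothEmbedding,
      range_incl := b₁.range_incl }
  let c₂ : NullCobordism (2 + 1) b₂.carrier :=
    { W := W₂, incl := b₂.incl, isSmoothEmbedding_incl := b₂.isSmoothEmbedding,
      range_incl := b₂.range_incl }
  -- the seam bijection `Ψ = incl₂⁻¹ ∘ e₂⁻¹ ∘ e₁ ∘ incl₁`
  have hex₁ : ∀ z : b₁.carrier, ∃ w : b₂.carrier, e₂ (b₂.incl w) = e₁ (b₁.incl z) := by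
    intro z
    have hmem : e₁ (b₁.incl z) ∈ range e₁ ∩ range e₂ := by
      rw [hI₁]
      exact ⟨b₁.incl z, b₁.incl_mem_boundary z, rfl⟩
    rw [hI₂] at hmem
    obtain ⟨w', hw', hw'e⟩ := hmem
    rw [← b₂.range_incl] at hw'
    obtain ⟨w, rfl⟩ := hw'
    exact ⟨w, hw'e⟩
  have hex₂ : ∀ w : b₂.carrier, ∃ z : b₁.carrier, e₁ (b₁.incl z) = e₂ (b₂.incl w) := by
    intro w
    have hmem : e₂ (b₂.incl w) ∈ range e₁ ∩ range e₂ := by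
      rw [hI₂]
      exact ⟨b₂.incl w, b₂.incl_mem_boundary w, rfl⟩
    rw [hI₁] at hmem
    obtain ⟨z', hz', hz'e⟩ := hmem
    rw [← b₁.range_incl] at hz'
    obtain ⟨z, rfl⟩ := hz'
    exact ⟨z, hz'e⟩
  choose ψ hψ using hex₁
  choose ψ' hψ' using hex₂
  have hinj₁ : Injective (e₁ ∘ b₁.incl) := h₁.isEmbedding.injective.comp b₁.injective_incl
  have hinj₂ : Injective (e₂ ∘ b₂.incl) := h₂.isEmbedding.injective.comp b₂.injective_incl
  let Ψ : b₁.carrier ≃ b₂.carrier :=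
    { toFun := ψ
      invFun := ψ'
      left_inv := fun z => hinj₁ (by
        show e₁ (b₁.incl (ψ' (ψ z))) = e₁ (b₁.incl z)
        rw [hψ', hψ])
      right_inv := fun w => hinj₂ (by
        show e₂ (b₂.incl (ψ (ψ' w))) = e₂ (b₂.incl w)
        rw [hψ, hψ']) }
  -- gluing data `M = W₁ ∪_Ψ W₂`
  let G : BoundaryGluingData c₁.boundaryData c₂.boundaryData Ψ M :=
    { jA := e₁
      jB := e₂
      isSmoothEmbedding_jA := h₁
      isSmoothEmbedding_jB := h₂
      range_union := hcov
      jA_eq_jB_iff := fun a a' => by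
        constructor
        · intro h
          have hmem : e₁ a ∈ range e₁ ∩ range e₂ := ⟨⟨a, rfl⟩, ⟨a', h.symm⟩⟩
          rw [hI₁] at hmem
          obtain ⟨a₀, ha₀, hae⟩ := hmem
          obtain rfl : a₀ = a := h₁.isEmbedding.injective hae
          have ha : a₀ ∈ range b₁.incl := by rw [b₁.range_incl]; exact ha₀
          obtain ⟨z, rfl⟩ := ha
          refine ⟨z, rfl, h₂.isEmbedding.injective ?_⟩
          show e₂ a' = e₂ (b₂.incl (ψ z))
          rw [hψ z]
          exact h.symm
        · rintro ⟨z, rfl, rfl⟩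
          exact (hψ z).symm }
  -- the seam is simply connected, seen from both sides
  have hsc₁ : IsSimplyConnected G.seam := by
    rw [← G.range_inter_range]
    exact hsc
  have hsc₂ : IsSimplyConnected G.symm.seam := by
    rw [← G.symm.range_inter_range]
    show IsSimplyConnected (range e₂ ∩ range e₁)
    rw [inter_comm]
    exact hsc
  -- the abstract boundaries are nonempty, path connected (homeomorphic to the seam), compact, T₂
  have hseam₁ : range e₁ ∩ range e₂ = range (e₁ ∘ b₁.incl) := G.range_inter_range
  have hseam₂ : range e₁ ∩ range e₂ = range (e₂ ∘ b₂.incl) := by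
    rw [inter_comm]
    exact G.symm.range_inter_range
  haveI : Nonempty b₁.carrier := by
    obtain ⟨⟨p, hp⟩⟩ := (inferInstance : Nonempty ↥(range e₁ ∩ range e₂))
    rw [hseam₁] at hp
    obtain ⟨z, -⟩ := hp
    exact ⟨z⟩
  haveI : Nonempty b₂.carrier := ⟨Ψ (Classical.arbitrary _)⟩
  have hpc : IsPathConnected (range e₁ ∩ range e₂) :=
    isPathConnected_iff_pathConnectedSpace.2 inferInstance
  haveI : PathConnectedSpace b₁.carrier := by
    have h := hpc
    rw [hseam₁] at h
    haveI := isPathConnected_iff_pathConnectedSpace.1 h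
    let η := (h₁.isEmbedding.comp b₁.isSmoothEmbedding.isEmbedding).toHomeomorph
    rw [pathConnectedSpace_iff_univ, ← η.symm.range_coe]
    exact isPathConnected_range η.symm.continuous
  haveI : PathConnectedSpace b₂.carrier := by
    have h := hpc
    rw [hseam₂] at h
    haveI := isPathConnected_iff_pathConnectedSpace.1 h
    let η := (h₂.isEmbedding.comp b₂.isSmoothEmbedding.isEmbedding).toHomeomorph
    rw [pathConnectedSpace_iff_univ, ← η.symm.range_coe]
    exact isPathConnected_range η.symm.continuous
  haveI : CompactSpace b₁.carrier := b₁.compactSpace_carrier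
  haveI : CompactSpace b₂.carrier := b₂.compactSpace_carrier
  haveI : T2Space b₁.carrier := b₁.isSmoothEmbedding.isEmbedding.t2Space
  haveI : T2Space b₂.carrier := b₂.isSmoothEmbedding.isEmbedding.t2Space
  -- both halves are contractible
  have hW₁ : ContractibleSpace c₁.W := contractibleSpace_left G hM hsc₁ hsc₂
  have hW₂ : ContractibleSpace c₂.W := contractibleSpace_left G.symm hM hsc₂ hsc₁
  exact ⟨hW₁, hW₂⟩

end Summit.SmoothPoincare4.SmoothPoincare4.Theorems

end

/-! ### File-level notation scope for the gate's closing probe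

The `open scoped …` lines near the top of this file sit inside `noncomputable section … end`, so
the notations `𝓡`, `𝓡∂`, `∞`, `≃ₕ` of the item's signature are out of scope after the final `end`,
which is where the gate appends its closing probe
`theorem _ : <signature> := by with_reducible exact <decl>` (it failed to parse there: "expected
token").  The following FILE-LEVEL `open`s (as in the route's other closing files, e.g.
`ConvexBisectionAcyclicRigidityBySectors.lean`) restore them for anything appended below. -/

open scoped Manifold ContDiff
open ContinuousMap

namespace Summit.SmoothPoincare4.SmoothPoincare4.Theorems

set_option linter.dupNamespace false in
/-- **Item stmt-SmoothPoincare4-15219 `ContractibleHalvesOfSimplyConnectedSeam` holds** — the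
item's signature verbatim, restated at FILE-LEVEL notation scope (see the section comment above)
so that the gate's appended closing probe elaborates; the proof is the theorem
`convexBisection_contractibleHalvesOfSimplyConnectedSeam` above (van Kampen over the bicollar of
the seam, Lefschetz duality and the sequence of the pair, recognition of compact simply connected
`4`-manifolds with connected nonempty boundary and `H₁ = H₂ = 0` as contractible).
[cite: HatcherAT2002, Thm. 1.20, Thm. 3.43, Thm. 4.5 and Cor. 4.33]
[cite: KervaireMilnorAnnals1963, p. 514] -/
theorem convexBisection_contractibleHalvesOfSimplyConnectedSeam_holds :
    ∀ (M : Type) [TopologicalSpace M] [T2Space M] [SecondCountableTopology M] [ChartedSpace (EuclideanSpace ℝ (Fin 4)) M] [IsManifold (𝓡 4) ∞ M], M ≃ₕ Metric.sphere (0 : EuclideanSpace ℝ (Fin 5)) 1 → ∀ (W₁ : Type) [TopologicalSpace W₁] [ChartedSpace (EuclideanHalfSpace 4) W₁] [IsManifold (𝓡∂ 4) ∞ W₁] [CompactSpace W₁] (W₂ : Type) [TopologicalSpace W₂] [ChartedSpace (EuclideanHalfSpace 4) W₂] [IsManifold (𝓡∂ 4) ∞ W₂] [CompactSpace W₂] (e₁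 : W₁ → M) (e₂ : W₂ → M), Manifold.IsSmoothEmbedding (𝓡∂ 4) (𝓡 4) ∞ e₁ → Manifold.IsSmoothEmbedding (𝓡∂ 4) (𝓡 4) ∞ e₂ → Set.range e₁ ∪ Set.range e₂ = Set.univ → Set.range e₁ ∩ Set.range e₂ = e₁ '' (𝓡∂ 4).boundary W₁ → Set.range e₁ ∩ Set.range e₂ = e₂ '' (𝓡∂ 4).boundary W₂ → SimplyConnectedSpace ↥(Set.range e₁ ∩ Set.range e₂) → ContractibleSpace W₁ ∧ ContractibleSpace W₂ :=
  convexBisection_contractibleHalvesOfSimplyConnectedSeam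

end Summit.SmoothPoincare4.SmoothPoincare4.Theorems
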